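import Mathlib
import Summits.Ventures.PercRepro2.V2SP
import Summits.Ventures.PercRepro2.Tail2DCount
import Summits.Ventures.PercRepro2.Tail2DThreePoint
import Summits.Ventures.PercRepro2.Tail2DP2Series
import Summits.Ventures.PercRepro2.Tail2DDisjointPaths
import Summits.Ventures.PercRepro2.Tail2DP2SeriesSP
import Summits.Ventures.PercRepro2.Tail2DAxisUnimodal

/-!
# Off the axis: `T(3,1) ≤ T(2,2)` on every series–parallel network (seat mine-b, cell pub-perc-repro2)

For every pattern `s` of the cell's grammar, uniformly two-coloured,

  `#{r ≥ 3 ∧ b ≥ 1} ≤ #{r ≥ 2 ∧ b ≥ 2}`   (`t31_le_t22`):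

three edge-disjoint red paths together with a blue path are rarer than two edge-disjoint red paths
together with two edge-disjoint blue paths — the first member `T(3,1) ≤ T(2,2)` of the off-axis
anti-diagonal unimodality `T(a, j) ≤ T(a−1, j+1)` (`a ≥ j + 2`) of the two-colour flow tail, whose
axis members `T(k+1, 0) ≤ T(k, 1)` are `tail_axis_unimodal`.

PROOF by induction over the grammar. Series multiplies both tails (`card_tail_ser`). For a parallel
composition the counts are bilinear in the CAPPED CELLS `cellCount s 3 x y = #{min r 3 = x ∧ min b 3 = y}`
of the factors (`card_par_capped`, by the fibres of `(min r 3, min b 3)` of both factors), the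
factors' tails are linear in their cells (`card_cells`), mirror cells are equal (`cellCount_symm`, the
colour swap), and the difference `T(2,2) − T(3,1)` of the composition is the explicit non-negative
combination

  `D₁(3,0)·#{r₂ = 0, b₂ ≥ 1} + D₁(3,1)·#{r₂ = b₂ = 0} + #{r₁ = b₁ = 0}·D₂(3,1) + #{r₁ = 0, b₁ ≥ 1}·D₂(3,0)
   + D₁(2,0)·D₂(2,0) + #{r₁ = 0, b₁ ≥ 2}·#{r₂ = 0, b₂ ≥ 2}`,

`D(a,j) = T(a−1, j+1) − T(a, j)`, in which `D(3,0)`, `D(2,0)` are the axis theorems and `D(3,1)` the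
induction hypothesis of the factors (registry §35.13: the identity was found as an LP certificate and
verified exactly on symmetric capped arrays; capping commutes with capped convolution).
-/

namespace Summit.Ventures.PercRepro2.Tail2D

open V2Closure

/-- the capped cell count `#{min r K = x ∧ min b K = y}` -/
def cellCount (s : V2Closure.SP) (K x y : ℕ) : ℕ :=
  (Finset.univ.filter (fun a : s.Conf => min (s.rLab a) K = x ∧ min (s.bLab a) K = y)).card

/-- the colour swap on capped cells -/
lemma cellCount_symm (s : V2Closure.SP) (K x y : ℕ) : cellCount s K x y = cellCount s K y x := by
  unfold cellCount
  rw [← card_swap s (fun r b => min r K = y ∧ min b K = x)]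
  congr 1; ext a; simp only [Finset.mem_filter, Finset.mem_univ, true_and]; exact and_comm

/-- the capped-cell decomposition of a count on one pattern -/
lemma card_cells (s : V2Closure.SP) (K : ℕ) (P : ℕ → ℕ → Prop) [∀ a b, Decidable (P a b)] :
    (Finset.univ.filter (fun a : s.Conf => P (min (s.rLab a) K) (min (s.bLab a) K))).card
      = ∑ x ∈ Finset.range (K + 1), ∑ y ∈ Finset.range (K + 1), if P x y then cellCount s K x y else 0 := by
  rw [Finset.card_eq_sum_card_fiberwise (f := fun a : s.Conf => (min (s.rLab a) K, min (s.bLab a) K))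
    (t := Finset.range (K + 1) ×ˢ Finset.range (K + 1))
    (fun a _ => by
      show (min (s.rLab a) K, min (s.bLab a) K) ∈ Finset.range (K + 1) ×ˢ Finset.range (K + 1)
      simp only [Finset.mem_product, Finset.mem_range]; omega), Finset.sum_product]
  refine Finset.sum_congr rfl (fun x _ => Finset.sum_congr rfl (fun y _ => ?_))
  split_ifs with hP
  · unfold cellCount
    congr 1; ext a
    simp only [Finset.mem_filter, Finset.mem_univ, true_and, Prod.mk.injEq]
    constructor
    · rintro ⟨_, h1, h2⟩; exact ⟨h1, h2⟩
    · rintro ⟨h1, h2⟩; exact ⟨by rw [h1, h2]; exact hP, h1, h2⟩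
  · rw [Finset.card_eq_zero]
    refine Finset.filter_eq_empty_iff.2 (fun a ha => ?_)
    simp only [Finset.mem_filter, Finset.mem_univ, true_and] at ha
    simp only [Prod.mk.injEq, not_and]
    intro h1 h2; rw [h1, h2] at ha; exact hP ha

/-- the capped-cell decomposition of a count on a parallel composition -/
lemma card_par_capped (s t : V2Closure.SP) (K : ℕ) (P : ℕ → ℕ → Prop) [∀ a b, Decidable (P a b)] :
    (Finset.univ.filter (fun p : (V2Closure.SP.par s t).Conf =>
        P (min ((V2Closure.SP.par s t).rLab p) K) (min ((V2Closure.SP.par s t).bLab p) K))).card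
      = ∑ x ∈ Finset.range (K + 1), ∑ y ∈ Finset.range (K + 1), ∑ u ∈ Finset.range (K + 1), ∑ v ∈ Finset.range (K + 1),
          if P (min (x + u) K) (min (y + v) K) then cellCount s K x y * cellCount t K u v else 0 := by
  change (Finset.univ.filter (fun p : s.Conf × t.Conf =>
      P (min (s.rLab p.1 + t.rLab p.2) K) (min (s.bLab p.1 + t.bLab p.2) K))).card = _
  rw [Finset.card_eq_sum_card_fiberwise
    (f := fun p : s.Conf × t.Conf => ((min (s.rLab p.1) K, min (s.bLab p.1) K), (min (t.rLab p.2) K, min (t.bLab p.2) K)))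
    (t := (Finset.range (K + 1) ×ˢ Finset.range (K + 1)) ×ˢ (Finset.range (K + 1) ×ˢ Finset.range (K + 1)))
    (fun p _ => by
      show ((min (s.rLab p.1) K, min (s.bLab p.1) K), (min (t.rLab p.2) K, min (t.bLab p.2) K))
        ∈ (Finset.range (K + 1) ×ˢ Finset.range (K + 1)) ×ˢ (Finset.range (K + 1) ×ˢ Finset.range (K + 1))
      simp only [Finset.mem_product, Finset.mem_range]; omega)]
  simp only [Finset.sum_product]
  refine Finset.sum_congr rfl (fun x _ => Finset.sum_congr rfl (fun y _ => Finset.sum_congr rfl (fun u _ =>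
    Finset.sum_congr rfl (fun v _ => ?_))))
  split_ifs with hP
  · unfold cellCount
    rw [Finset.filter_filter, Finset.card_filter, Finset.card_filter, Finset.card_filter,
      ← sum_prod_ite s t (fun a => min (s.rLab a) K = x ∧ min (s.bLab a) K = y) (fun b => min (t.rLab b) K = u ∧ min (t.bLab b) K = v)]
    refine Finset.sum_congr rfl (fun p _ => ?_)
    simp only [Prod.mk.injEq]
    by_cases hc : (min (s.rLab p.1) K = x ∧ min (s.bLab p.1) K = y) ∧ (min (t.rLab p.2) K = u ∧ min (t.bLab p.2) K = v)
    · have e1 : min (s.rLab p.1 + t.rLab p.2) K = min (x + u) K := by omega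
      have e2 : min (s.bLab p.1 + t.bLab p.2) K = min (y + v) K := by omega
      rw [if_pos hc, if_pos ⟨by rw [e1, e2]; exact hP, hc⟩]
    · rw [if_neg hc, if_neg (fun h => hc h.2)]
  · rw [Finset.card_eq_zero]
    refine Finset.filter_eq_empty_iff.2 (fun p hp => ?_)
    simp only [Finset.mem_filter, Finset.mem_univ, true_and] at hp
    simp only [Prod.mk.injEq, not_and]
    intro h1 h2 h3
    have e1 : min (s.rLab p.1 + t.rLab p.2) K = min (x + u) K := by omega
    have e2 : min (s.bLab p.1 + t.bLab p.2) K = min (y + v) K := by omega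
    rw [e1, e2] at hp; exact hP hp


/-- series: the tail `#{a ≤ r ∧ j ≤ b}` multiplies -/
lemma card_tail_ser (s t : V2Closure.SP) (a j : ℕ) :
    (Finset.univ.filter (fun y : (V2Closure.SP.ser s t).Conf =>
        a ≤ (V2Closure.SP.ser s t).rLab y ∧ j ≤ (V2Closure.SP.ser s t).bLab y)).card
      = (Finset.univ.filter (fun y : s.Conf => a ≤ s.rLab y ∧ j ≤ s.bLab y)).card
        * (Finset.univ.filter (fun y : t.Conf => a ≤ t.rLab y ∧ j ≤ t.bLab y)).card := by
  simp only [Finset.card_filter]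
  rw [← sum_prod_ite s t (fun y => a ≤ s.rLab y ∧ j ≤ s.bLab y) (fun y => a ≤ t.rLab y ∧ j ≤ t.bLab y)]
  refine Finset.sum_congr rfl (fun y _ => ?_)
  simp only [SP.rLab, SP.bLab, serR, serB]
  split_ifs <;> omega

/-- a tail with thresholds `≤ 3` in the capped cells (`K = 3`) -/
lemma tail_cells3 (s : V2Closure.SP) (a j : ℕ) (ha : a ≤ 3) (hj : j ≤ 3) :
    (Finset.univ.filter (fun y : s.Conf => a ≤ s.rLab y ∧ j ≤ s.bLab y)).card
      = ∑ x ∈ Finset.range 4, ∑ y ∈ Finset.range 4, if a ≤ x ∧ j ≤ y then cellCount s 3 x y else 0 := by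
  have e : (Finset.univ.filter (fun y : s.Conf => a ≤ s.rLab y ∧ j ≤ s.bLab y))
      = Finset.univ.filter (fun y : s.Conf => a ≤ min (s.rLab y) 3 ∧ j ≤ min (s.bLab y) 3) := by
    ext y; simp only [Finset.mem_filter, Finset.mem_univ, true_and]; omega
  rw [e]; exact card_cells s 3 (fun r b => a ≤ r ∧ j ≤ b)

/-- a tail of a parallel composition with thresholds `≤ 3` in the capped cells of the factors -/
lemma tail_par_cells3 (s t : V2Closure.SP) (a j : ℕ) (ha : a ≤ 3) (hj : j ≤ 3) :
    (Finset.univ.filter (fun p : (V2Closure.SP.par s t).Conf =>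
        a ≤ (V2Closure.SP.par s t).rLab p ∧ j ≤ (V2Closure.SP.par s t).bLab p)).card
      = ∑ x ∈ Finset.range 4, ∑ y ∈ Finset.range 4, ∑ u ∈ Finset.range 4, ∑ v ∈ Finset.range 4,
          if a ≤ min (x + u) 3 ∧ j ≤ min (y + v) 3 then cellCount s 3 x y * cellCount t 3 u v else 0 := by
  have e : (Finset.univ.filter (fun p : (V2Closure.SP.par s t).Conf =>
        a ≤ (V2Closure.SP.par s t).rLab p ∧ j ≤ (V2Closure.SP.par s t).bLab p))
      = Finset.univ.filter (fun p : (V2Closure.SP.par s t).Conf =>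
        a ≤ min ((V2Closure.SP.par s t).rLab p) 3 ∧ j ≤ min ((V2Closure.SP.par s t).bLab p) 3) := by
    ext p; simp only [Finset.mem_filter, Finset.mem_univ, true_and]; omega
  rw [e]; exact card_par_capped s t 3 (fun r b => a ≤ r ∧ j ≤ b)

/-- the parallel step of `T(3,1) ≤ T(2,2)` -/
lemma t31_le_t22_par (s t : V2Closure.SP)
    (hs : (Finset.univ.filter (fun y : s.Conf => 3 ≤ s.rLab y ∧ 1 ≤ s.bLab y)).card
      ≤ (Finset.univ.filter (fun y : s.Conf => 2 ≤ s.rLab y ∧ 2 ≤ s.bLab y)).card)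
    (ht : (Finset.univ.filter (fun y : t.Conf => 3 ≤ t.rLab y ∧ 1 ≤ t.bLab y)).card
      ≤ (Finset.univ.filter (fun y : t.Conf => 2 ≤ t.rLab y ∧ 2 ≤ t.bLab y)).card) :
    (Finset.univ.filter (fun p : (V2Closure.SP.par s t).Conf =>
        3 ≤ (V2Closure.SP.par s t).rLab p ∧ 1 ≤ (V2Closure.SP.par s t).bLab p)).card
      ≤ (Finset.univ.filter (fun p : (V2Closure.SP.par s t).Conf =>
        2 ≤ (V2Closure.SP.par s t).rLab p ∧ 2 ≤ (V2Closure.SP.par s t).bLab p)).card := by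
  -- the axis theorems for the factors: `T(3,0) ≤ T(2,1)` and `T(2,0) ≤ T(1,1)`
  have a3s := tail_axis_unimodal s 2
  have a3t := tail_axis_unimodal t 2
  have a2s := tail_axis_unimodal s 1
  have a2t := tail_axis_unimodal t 1
  have z0s : (Finset.univ.filter (fun y : s.Conf => 3 ≤ s.rLab y)).card
      = (Finset.univ.filter (fun y : s.Conf => 3 ≤ s.rLab y ∧ 0 ≤ s.bLab y)).card := by
    congr 1; ext y; simp
  have z0t : (Finset.univ.filter (fun y : t.Conf => 3 ≤ t.rLab y)).card
      = (Finset.univ.filter (fun y : t.Conf => 3 ≤ t.rLab y ∧ 0 ≤ t.bLab y)).card := by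
    congr 1; ext y; simp
  have y0s : (Finset.univ.filter (fun y : s.Conf => 2 ≤ s.rLab y)).card
      = (Finset.univ.filter (fun y : s.Conf => 2 ≤ s.rLab y ∧ 0 ≤ s.bLab y)).card := by
    congr 1; ext y; simp
  have y0t : (Finset.univ.filter (fun y : t.Conf => 2 ≤ t.rLab y)).card
      = (Finset.univ.filter (fun y : t.Conf => 2 ≤ t.rLab y ∧ 0 ≤ t.bLab y)).card := by
    congr 1; ext y; simp
  rw [z0s] at a3s; rw [z0t] at a3t; rw [y0s] at a2s; rw [y0t] at a2t
  -- everything in cells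
  rw [tail_cells3 s 3 1 (by norm_num) (by norm_num), tail_cells3 s 2 2 (by norm_num) (by norm_num)] at hs
  rw [tail_cells3 t 3 1 (by norm_num) (by norm_num), tail_cells3 t 2 2 (by norm_num) (by norm_num)] at ht
  rw [tail_cells3 s 3 0 (by norm_num) (by norm_num), tail_cells3 s 2 1 (by norm_num) (by norm_num)] at a3s
  rw [tail_cells3 t 3 0 (by norm_num) (by norm_num), tail_cells3 t 2 1 (by norm_num) (by norm_num)] at a3t
  rw [tail_cells3 s 2 0 (by norm_num) (by norm_num), tail_cells3 s 1 1 (by norm_num) (by norm_num)] at a2s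
  rw [tail_cells3 t 2 0 (by norm_num) (by norm_num), tail_cells3 t 1 1 (by norm_num) (by norm_num)] at a2t
  rw [tail_par_cells3 s t 3 1 (by norm_num) (by norm_num), tail_par_cells3 s t 2 2 (by norm_num) (by norm_num)]
  simp only [Finset.sum_range_succ, Finset.sum_range_zero] at hs ht a3s a3t a2s a2t ⊢
  norm_num [Nat.min_def] at hs ht a3s a3t a2s a2t ⊢
  -- mirror cells
  rw [cellCount_symm s 3 1 0, cellCount_symm s 3 2 0, cellCount_symm s 3 2 1, cellCount_symm s 3 3 0,
    cellCount_symm s 3 3 1, cellCount_symm s 3 3 2, cellCount_symm t 3 1 0, cellCount_symm t 3 2 0,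
    cellCount_symm t 3 2 1, cellCount_symm t 3 3 0, cellCount_symm t 3 3 1, cellCount_symm t 3 3 2] at *
  -- the certificate
  zify at hs ht a3s a3t a2s a2t ⊢
  have h1 := mul_nonneg (sub_nonneg.2 a3s)
    (by positivity : (0 : ℤ) ≤ cellCount t 3 0 1 + cellCount t 3 0 2 + cellCount t 3 0 3)
  have h2 := mul_nonneg (sub_nonneg.2 hs) (by positivity : (0 : ℤ) ≤ cellCount t 3 0 0)
  have h3 := mul_nonneg (by positivity : (0 : ℤ) ≤ cellCount s 3 0 0) (sub_nonneg.2 ht)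
  have h4 := mul_nonneg (by positivity : (0 : ℤ) ≤ cellCount s 3 0 1 + cellCount s 3 0 2 + cellCount s 3 0 3)
    (sub_nonneg.2 a3t)
  have h5 := mul_nonneg (sub_nonneg.2 a2s) (sub_nonneg.2 a2t)
  have h6 := mul_nonneg (by positivity : (0 : ℤ) ≤ cellCount s 3 0 2 + cellCount s 3 0 3)
    (by positivity : (0 : ℤ) ≤ cellCount t 3 0 2 + cellCount t 3 0 3)
  linarith [h1, h2, h3, h4, h5, h6]

/-- **three disjoint red paths with a blue path are rarer than two disjoint red paths with two
disjoint blue paths**, on every pattern of the grammar: `T(3,1) ≤ T(2,2)` -/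
theorem t31_le_t22 : ∀ s : V2Closure.SP,
    (Finset.univ.filter (fun y : s.Conf => 3 ≤ s.rLab y ∧ 1 ≤ s.bLab y)).card
      ≤ (Finset.univ.filter (fun y : s.Conf => 2 ≤ s.rLab y ∧ 2 ≤ s.bLab y)).card
  | .free => by decide
  | .pin => by decide
  | .absent => by decide
  | .ser s t => by
    rw [card_tail_ser, card_tail_ser]
    exact Nat.mul_le_mul (t31_le_t22 s) (t31_le_t22 t)
  | .par s t => t31_le_t22_par s t (t31_le_t22 s) (t31_le_t22 t)

/-- the same in the vocabulary of `Tail2DP2Series` -/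
theorem stat_t31_le_t22 (s : V2Closure.SP) :
    stat s (fun r b => 3 ≤ r ∧ 1 ≤ b) ≤ stat s (fun r b => 2 ≤ r ∧ 2 ≤ b) :=
  t31_le_t22 s

end Summit.Ventures.PercRepro2.Tail2D
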